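import Mathlib.MeasureTheory.Function.AbsolutelyContinuous
import Mathlib.MeasureTheory.Integral.IntervalIntegral.LebesgueDifferentiationThm
import Mathlib.MeasureTheory.Integral.DominatedConvergence
import HarnessLib

/-!
# Rodgers–Tao 2020, Proposition 22 — the «dominated convergence + Lebesgue differentiation» step (P22 STAGE A0, abstract)

RH-FREE CONTENT (0 defs / 0 named facts). In the proof of **Proposition 22** of Rodgers–Tao,
*The de Bruijn–Newman constant is non-negative*, Forum Math. Pi 8 (2020) e6 (pp. 48–49;
= arXiv:1801.05914v4 Prop. 7.7), the absolute continuity of the smoothly truncated Hamiltonian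
`H̃_T(t) = Σ_{j ∼_T k} ψ_T(j)ψ_T(k)(H_{jk}(t) − log(1/|ξ_j − ξ_k|))` and the almost-everywhere formula
for its derivative are obtained as follows: each term satisfies the fundamental theorem of calculus
`H_{jk}(0) − H_{jk}(t₀) = −2∫_{t₀}^0 (…) dt` (from (56)); «By the dominated convergence theorem, we can
interchange the outer sum and the integral as soon as we can show that the expression
`Σ_{j∼_T k} ψ_T(j)ψ_T(k) ∫_{t₀}^0 |…| dt` is finite. […] The above analysis also shows that the integrand
is absolutely integrable in time. From the Lebesgue differentiation theorem, we conclude that `H̃_T`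
is absolutely continuous and that (formal-oda) holds at almost every time `t`.»

This module proves that step as an ABSTRACT theorem about a countable family of real functions on
an interval `[a, b]`:

* `RodgersTaoSeriesAbsContinuity.integrable_tsum_of_summable_integral_abs` — an `L¹`-summable
  countable family `g_p` is almost everywhere summable and `s ↦ Σ'_p g_p(s)` is integrable;
* `RodgersTaoSeriesAbsContinuity.hasSum_of_termwise_integral` — if `f_p(t) − f_p(a) = ∫_a^t g_p`
  on `[a, b]`, `Σ_p ∫_{(a,b]} |g_p| < ∞` and `Σ_p f_p(a)` converges, then for every `t ∈ [a, b]`,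
  `Σ_p f_p(t) = Σ'_p f_p(a) + ∫_a^t Σ'_p g_p` («interchange the outer sum and the integral»);
* `RodgersTaoSeriesAbsContinuity.absolutelyContinuousOnInterval_congr` — absolute continuity on
  `[a, b]` only depends on the values on `[a, b]`;
* `RodgersTaoSeriesAbsContinuity.absolutelyContinuousOnInterval_tsum` — under the same hypotheses
  `t ↦ Σ'_p f_p(t)` is absolutely continuous on `[a, b]` and has derivative `Σ'_p g_p(s)` at almost
  every `s ∈ (a, b)` («From the Lebesgue differentiation theorem, we conclude …»).

The consumer is the (future) content twin of Proposition 22 (`rodgers_tao_truncHamiltonian_deriv`),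
with index set `nearbyPairs T`, `f_p = ψ_T(j)ψ_T(k)(H_{jk} − log(1/|ξ_j − ξ_k|))`, `g_p` from (56), and
the `L¹`-summability supplied by Proposition 15, exactly as printed.

LABEL: RH-FREE; bears_on N-C/N-P (COLUMN 3, de Bruijn–Newman side). WHAT THIS IS NOT: not
Proposition 22; nothing here bears on the truth of RH.

## References
* [RodgersTaoFMP2020] B. Rodgers, T. Tao, *The de Bruijn–Newman constant is non-negative*, Forum
  Math. Pi 8 (2020), e6 — Prop. 22, proof, pp. 48–49 (= arXiv:1801.05914v4 Prop. 7.7).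
-/

noncomputable section

open Real Set Filter Topology MeasureTheory

namespace Literature.NumberTheory.LFunctions

namespace RodgersTaoSeriesAbsContinuity

variable {ι : Type*} [Countable ι]

/-! ## An `L¹`-summable family is a.e. summable with integrable sum -/

/-- If `Σ_p ∫ |g_p| < ∞` for a countable family of integrable real functions, then `Σ_p g_p(s)`
converges absolutely for almost every `s` and `s ↦ Σ'_p g_p(s)` is integrable («the above analysis
also shows that the integrand is absolutely integrable in time»).
[cite: RodgersTaoFMP2020, Prop. 22 p. 48–49 (proof)] -/
theorem integrable_tsum_of_summable_integral_abs {μ : Measure ℝ} {g : ι → ℝ → ℝ}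
    (hg : ∀ p, Integrable (g p) μ) (hsum : Summable fun p ↦ ∫ s, |g p s| ∂μ) :
    (∀ᵐ s ∂μ, Summable fun p ↦ |g p s|) ∧ Integrable (fun s ↦ ∑' p, g p s) μ := by
  have hmeas : ∀ p, AEMeasurable (fun s ↦ ‖g p s‖ₑ) μ :=
    fun p ↦ (hg p).aestronglyMeasurable.enorm
  have h1 : ∀ p, ∫⁻ s, ‖g p s‖ₑ ∂μ = ENNReal.ofReal (∫ s, |g p s| ∂μ) := by
    intro p
    rw [← ofReal_integral_norm_eq_lintegral_enorm (hg p)]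
    simp only [Real.norm_eq_abs]
  have h2 : ∫⁻ s, ∑' p, ‖g p s‖ₑ ∂μ = ∑' p, ∫⁻ s, ‖g p s‖ₑ ∂μ := lintegral_tsum hmeas
  have h3 : ∑' p, ∫⁻ s, ‖g p s‖ₑ ∂μ ≠ ⊤ := by
    simp_rw [h1]
    rw [← ENNReal.ofReal_tsum_of_nonneg (fun p ↦ integral_nonneg fun s ↦ abs_nonneg _) hsum]
    exact ENNReal.ofReal_ne_top
  have h4 : ∫⁻ s, ∑' p, ‖g p s‖ₑ ∂μ ≠ ⊤ := h2 ▸ h3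
  have hmeas' : AEMeasurable (fun s ↦ ∑' p, ‖g p s‖ₑ) μ := by
    simp_rw [ENNReal.tsum_eq_iSup_sum]
    exact AEMeasurable.iSup fun S ↦ Finset.aemeasurable_fun_sum S fun i _ ↦ hmeas i
  have h5 : ∀ᵐ s ∂μ, ∑' p, ‖g p s‖ₑ < ⊤ := ae_lt_top' hmeas' h4
  have h6 : ∀ᵐ s ∂μ, Summable fun p ↦ |g p s| := by
    filter_upwards [h5] with s hs
    have hnn : Summable fun p ↦ ‖g p s‖₊ := by
      rw [← ENNReal.tsum_coe_ne_top_iff_summable]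
      simpa only [enorm_eq_nnnorm] using hs.ne
    have hR : Summable fun p ↦ ((‖g p s‖₊ : NNReal) : ℝ) := NNReal.summable_coe.2 hnn
    simpa only [coe_nnnorm, Real.norm_eq_abs] using hR
  have h7 : AEStronglyMeasurable (fun s ↦ ∑' p, g p s) μ := by
    refine aestronglyMeasurable_of_tendsto_ae (atTop : Filter (Finset ι))
      (f := fun S s ↦ ∑ p ∈ S, g p s) (fun S ↦ ?_) ?_
    · exact Finset.aestronglyMeasurable_fun_sum S fun p _ ↦ (hg p).aestronglyMeasurable
    · filter_upwards [h6] with s hs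
      have hs' : Summable fun p ↦ g p s := hs.of_abs
      have := hs'.hasSum
      simpa only [HasSum, SummationFilter.unconditional_filter] using this
  refine ⟨h6, h7, ?_⟩
  -- finite integral: `‖Σ' g_p(s)‖ ≤ Σ' |g_p(s)|` almost everywhere
  refine lt_of_le_of_lt (lintegral_mono_ae ?_) (lt_top_iff_ne_top.2 h4)
  filter_upwards [h6] with s hs
  have hle : ‖∑' p, g p s‖ ≤ ∑' p, ‖g p s‖ :=
    norm_tsum_le_tsum_norm (by simpa only [Real.norm_eq_abs] using hs)
  have hs' : Summable fun p ↦ ‖g p s‖ := by simpa only [Real.norm_eq_abs] using hs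
  calc ‖∑' p, g p s‖ₑ = ENNReal.ofReal ‖∑' p, g p s‖ := (ofReal_norm _).symm
    _ ≤ ENNReal.ofReal (∑' p, ‖g p s‖) := ENNReal.ofReal_le_ofReal hle
    _ = ∑' p, ENNReal.ofReal ‖g p s‖ := ENNReal.ofReal_tsum_of_nonneg (fun _ ↦ norm_nonneg _) hs'
    _ = ∑' p, ‖g p s‖ₑ := by simp_rw [ofReal_norm]

/-! ## Interchanging the sum and the integral -/

/-- «By the dominated convergence theorem, we can interchange the outer sum and the integral»: if
`f_p(t) − f_p(a) = ∫_a^t g_p` on `[a, b]` for every `p`, `Σ_p ∫_{(a,b]} |g_p| < ∞` and `Σ_p f_p(a)`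
converges, then for every `t ∈ [a, b]` the series `Σ_p f_p(t)` converges to
`Σ'_p f_p(a) + ∫_a^t Σ'_p g_p`. [cite: RodgersTaoFMP2020, Prop. 22 p. 48–49 (proof)] -/
theorem hasSum_of_termwise_integral {a b : ℝ} {f g : ι → ℝ → ℝ}
    (hg : ∀ p, IntegrableOn (g p) (Ioc a b))
    (hsum : Summable fun p ↦ ∫ s in Ioc a b, |g p s|)
    (hftc : ∀ p, ∀ t ∈ Icc a b, f p t - f p a = ∫ s in a..t, g p s)
    (hfa : Summable fun p ↦ f p a) {t : ℝ} (ht : t ∈ Icc a b) :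
    HasSum (fun p ↦ f p t) (∑' p, f p a + ∫ s in a..t, ∑' p, g p s) := by
  have hat : a ≤ t := ht.1
  have hsub : Ioc a t ⊆ Ioc a b := Ioc_subset_Ioc_right ht.2
  have hg' : ∀ p, Integrable (g p) (volume.restrict (Ioc a t)) := fun p ↦ (hg p).mono_set hsub
  have hsum' : Summable fun p ↦ ∫ s in Ioc a t, ‖g p s‖ := by
    refine hsum.of_nonneg_of_le (fun p ↦ integral_nonneg fun s ↦ norm_nonneg _) fun p ↦ ?_
    simp only [Real.norm_eq_abs]
    exact setIntegral_mono_set (hg p).abs (ae_of_all _ fun s ↦ abs_nonneg _) hsub.eventuallyLE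
  have hH := hasSum_integral_of_summable_integral_norm hg' hsum'
  have heq : (fun p ↦ f p t - f p a) = fun p ↦ ∫ s in Ioc a t, g p s :=
    funext fun p ↦ by rw [hftc p t ht, intervalIntegral.integral_of_le hat]
  have hH' : HasSum (fun p ↦ f p t - f p a) (∫ s in a..t, ∑' p, g p s) := by
    rw [intervalIntegral.integral_of_le hat, heq]
    exact hH
  have := hfa.hasSum.add hH'
  simpa only [add_sub_cancel] using this

/-! ## Absolute continuity only depends on the values on the interval -/

/-- Absolute continuity on `uIcc a b` only depends on the values of the function on `uIcc a b`.
[cite: RodgersTaoFMP2020, Prop. 22 p. 48–49 (proof)] -/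
theorem absolutelyContinuousOnInterval_congr {F H : ℝ → ℝ} {a b : ℝ} (h : EqOn F H (uIcc a b))
    (hH : AbsolutelyContinuousOnInterval H a b) : AbsolutelyContinuousOnInterval F a b := by
  rw [absolutelyContinuousOnInterval_iff] at hH ⊢
  intro ε hε
  obtain ⟨δ, hδ, hE⟩ := hH ε hε
  refine ⟨δ, hδ, fun E hEmem hEsum ↦ ?_⟩
  have hmem := hEmem.1
  calc ∑ i ∈ Finset.range E.1, dist (F (E.2 i).1) (F (E.2 i).2)
      = ∑ i ∈ Finset.range E.1, dist (H (E.2 i).1) (H (E.2 i).2) := by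
        refine Finset.sum_congr rfl fun i hi ↦ ?_
        rw [h (hmem i hi).1, h (hmem i hi).2]
    _ < ε := hE E hEmem hEsum

/-! ## Absolute continuity and the a.e. derivative of the sum -/

/-- «From the Lebesgue differentiation theorem, we conclude that `H̃_T` is absolutely continuous and
that (formal-oda) holds at almost every time `t`», abstractly: under the hypotheses of
`hasSum_of_termwise_integral` (with `a ≤ b`), `G := Σ'_p g_p` is interval integrable on `[a, b]`,
`F := Σ'_p f_p` equals `Σ'_p f_p(a) + ∫_a^t G` on `[a, b]`, is absolutely continuous there, and
`F'(s) = G(s)` for almost every `s ∈ (a, b)`. [cite: RodgersTaoFMP2020, Prop. 22 p. 48–49 (proof)] -/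
theorem absolutelyContinuousOnInterval_tsum {a b : ℝ} (hab : a ≤ b) {f g : ι → ℝ → ℝ}
    (hg : ∀ p, IntegrableOn (g p) (Ioc a b))
    (hsum : Summable fun p ↦ ∫ s in Ioc a b, |g p s|)
    (hftc : ∀ p, ∀ t ∈ Icc a b, f p t - f p a = ∫ s in a..t, g p s)
    (hfa : Summable fun p ↦ f p a) :
    IntervalIntegrable (fun s ↦ ∑' p, g p s) volume a b ∧
    (∀ t ∈ Icc a b, ∑' p, f p t = ∑' p, f p a + ∫ s in a..t, ∑' p, g p s) ∧
    AbsolutelyContinuousOnInterval (fun t ↦ ∑' p, f p t) a b ∧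
    ∀ᵐ s, s ∈ Ioo a b → HasDerivAt (fun t ↦ ∑' p, f p t) (∑' p, g p s) s := by
  -- integrability of `G` on `(a, b]`
  have hG : IntegrableOn (fun s ↦ ∑' p, g p s) (Ioc a b) :=
    (integrable_tsum_of_summable_integral_abs (μ := volume.restrict (Ioc a b)) hg hsum).2
  have hGint : IntervalIntegrable (fun s ↦ ∑' p, g p s) volume a b :=
    (intervalIntegrable_iff_integrableOn_Ioc_of_le hab).2 hG
  -- the representation `F = C + ∫_a^t G` on `[a, b]`
  have hrep : ∀ t ∈ Icc a b, ∑' p, f p t = ∑' p, f p a + ∫ s in a..t, ∑' p, g p s :=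
    fun t ht ↦ (hasSum_of_termwise_integral hg hsum hftc hfa ht).tsum_eq
  refine ⟨hGint, hrep, ?_, ?_⟩
  · -- absolute continuity
    have hI : AbsolutelyContinuousOnInterval (fun t ↦ ∫ s in a..t, ∑' p, g p s) a b :=
      hGint.absolutelyContinuousOnInterval_intervalIntegral (c := a) (by simp)
    have hC : AbsolutelyContinuousOnInterval (fun _ : ℝ ↦ ∑' p, f p a) a b :=
      ((LipschitzWith.const (∑' p, f p a)).lipschitzOnWith (s := uIcc a b))
        |>.absolutelyContinuousOnInterval
    refine absolutelyContinuousOnInterval_congr (fun t ht ↦ ?_) (hC.add hI)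
    rw [uIcc_of_le hab] at ht
    simpa using hrep t ht
  · -- the a.e. derivative
    have hD := hGint.ae_hasDerivAt_integral
    filter_upwards [hD] with s hs hmem
    have hsI : s ∈ uIcc a b := by
      rw [uIcc_of_le hab]
      exact Ioo_subset_Icc_self hmem
    have haI : a ∈ uIcc a b := by simp
    have h1 : HasDerivAt (fun t ↦ ∑' p, f p a + ∫ x in a..t, ∑' p, g p x) (∑' p, g p s) s :=
      (hs hsI a haI).const_add _
    refine h1.congr_of_eventuallyEq ?_
    -- `F = C + ∫ G` on the neighbourhood `Ioo a b` of `s`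
    filter_upwards [Ioo_mem_nhds hmem.1 hmem.2] with t ht
    exact hrep t (Ioo_subset_Icc_self ht)

end RodgersTaoSeriesAbsContinuity

end Literature.NumberTheory.LFunctions

end
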